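import Summits.QuantumFields.YangMills.Theorems.BalabanUVNodesN22AtGeneratedHistory13
import Summits.QuantumFields.YangMills.Theorems.BalabanUVNodesN22EdgeAtW1AdmReadingOfRecord13Co
import Summits.QuantumFields.YangMills.Theorems.BalabanUVNodesN22AtGeneratedHistory12Below

/-!
# CORE EDITION of 8c″ `BalabanUVNodesN22AtGeneratedHistory13` (p496320) — N22 on the GENERATED run towers `runTowers (toClusterTower ∘ G)` — sharp schema package, `ofRecordAdm` ∕ `ofRecordGen`, both homes, the tuple-reading conjunct — KEYED ON THE bg-FREE PROVISO CORE `Stage13Params.Provisos₁₃Core` (the LAST re-key of this module).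
#
# WHY THIS FILE EXISTS (plan g67 ★ CORE-YES, pub-ymgap INBOX l.17420; WORD-139 (1) l.16747; dag-lead WORDS-139 (3) l.16541; RR-2 g11 CORE l.17476; this seat's
# DESIGN-INPUT-CORE l.17415).  The Stage-13 record's proviso structure is being re-pinned row by row toward print (v1.1 `Provisos₁₃` → v1.2 `Provisos₁₃Sep`
# (separated sequences + `PartCompat₁₃`, director-ym №136–№139) → v1.3 `Provisos₁₃SepMixed` (+ `Sect2.DataSmall7`, №142) → …); each edition re-mints the four cruxes and
# would re-key every storey typed `∀ θ (h : θ.Provisos₁₃<ed> F N), …`.  But the rate-side storeys are bg-BLIND and proviso-FIELD-blind: `h` enters only as a binder TYPE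
# and inside `datumOfRecord₁₃<ed> F N θ h`; def-T's `Node00/Record13` v1.2 (p501191) carries the edition-free proviso CORE `Stage13Params.Provisos₁₃Core` (the nine non-bg rows)
# with the maps `Provisos₁₃<ed>.toCore`, and — after director-ym №151∕№152 re-based the record at print's background U_k(V) (`UbgOfRecord₁₃Co`) — def-T's FILE 21
# `Node00/Record13Co` (p515035) carries the Core-KEYED tower ∕ datum ∕ record `towerOfRecord₁₃Co ∕ datumOfRecord₁₃Co ∕ IsRecordOfRecord₁₃CCo` with the `rfl` bridges
# `datumOfRecord₁₃<ed> F N θ h = datumOfRecord₁₃Co F N θ h.toCore` for every LATER edition (v1.4 `SepCo`, KEY-RULE-21 R4; v1.2's U_old `datumOfRecord₁₃Core` is superseded,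
# def-T HOLD-21C).  So plan ruled (CORE-YES):
# CONSUMER storeys key ONCE on `(hc : θ.Provisos₁₃Core F N)` ∕ `datumOfRecord₁₃Co` ∕ RR-2's bg-free datum key `Node00/Record13DatumKeyCo` (p515777; its `IsDatumOfRecord…` ∕ `IsRateKey…` classes,
# the record classes `IsRecordOfRecord…`, one-way bridges `.toCore` from every edition's keys), while the ITEM texts and the registered STUB texts stay
# edition-keyed and ONLY the K3 composer touches the item's proviso token — at an item tuple `(θ, h : θ.Provisos₁₃<ed> F 2)` it applies these storeys at `hc := h.toCore`,
# datum by `rfl`.  This file is the (T-RATE) pen's CORE twin of its own ‴ module under the token map `Provisos₁₃ ↦ Provisos₁₃Core` · `datumOfRecord₁₃ ↦ datumOfRecord₁₃Core` ·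
# `(Is|is)DatumOfRecord₁₃C… ↦ …₁₃CCore…` · `(Is|is)RecordOfRecord₁₃C… ↦ …₁₃CCore…` · `IsRateKey₁₃ ↦ IsRateKey₁₃Core` and, for THIS seat's names, `Core` inserted after `₁₃`
# in the stage-KEYED stems only (`RateReading₁₃`, `rateCarriersOfRecord₁₃`, `RRec₁₃(On)`, `rRec₁₃…`, `readingOfRecord₁₃`, `…datumKey₁₃…`, `n22_tupleReadingOfRecord(On)…`).
# EVERYTHING θ-LEVEL IS UNCHANGED AND NOT RE-DECLARED: `Stage13Params`, `u3OfRecord₁₃ θ u k` and its faces, the θ-form closers `n22At_u3OfRecord₁₃_…` of the ‴ modules carry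
# no proviso and are IMPORTED BY NAME (this module imports its ‴ original) — here: `n22At_u3OfRecord₁₃_ofRecordAdm_gen_of_n18Below_schemasBelow`, `n22At_u3OfRecord₁₃_ofRecordGen_gen_of_n18Below_schemasBelow`.  Statements = the ‴ statements under the map, proofs = the ‴ proofs verbatim.  The ⁗
# `…13Sep…` twin of this module (rev-18∕19 homes) stays in the tree as the ⁗ asides' context.  NOMINAL STRENGTH: Core-keyed storeys quantify over more tuples (no bg row) —
# harmless: every hypothesis here is θ-generic under `θ.Admissible` and the slot data, none reads `bg`.
#
# ITEM IDS: crux names ∕ item ids quoted in the ‴ header below (K0‴–K3‴ = stmt-QuantumFields-19909…19912) are the rev-16∕17 ones, ASIDES now; this file is filed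
# `--supports stmt-QuantumFields-20292` (the K3 item of record at filing time, per dag-lead's KEY MAP) as a HELPER — count-neutral, no stub closed, N22 NOT discharged, no inhabitant of
# any key claimed (K0 OPEN at every edition).
#
# ‴ HEADER OF RECORD FOLLOWS (token-mapped; its decl lists are this file's, the θ-only names above excepted):
#
# BalabanUVNodes ∕ node N22 AT THE ADMISSIBLE W1 READING OF THE STAGE-13 RECORD ON node00-def-W1's GENERATED RUN TOWERS `runTowers (fun k ↦ toClusterTower (G k))` —
# the SHARP SCHEMA PACKAGE at Stage 13: `S_N22 (RRec₁₃Co 𝔯)` ∕ `S_N22 (RRec₁₃CoOn 𝔯 Rg)` at every Stage-13 reading pinned to the admissible reading on the generated towers, and at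
# the Stage-13 reading of record (module 6″) with the `ofRecordAdm` ∕ `ofRecordGen` W1 component ⟸ `S_N18` at the same reading + W1's per-step analyticity schemas BELOW the run
# length + ONE displayed complex sup-letter inequality + numerals ((J), coherence, readings ∕ transport clauses all discharged by construction)

Track A of `YM-PLAN.md` (cell `pub-ymgap`, HUMAN RULING D-0062), R134 seat `pub-ymgap-dag-n22-e` (s2 «`FadingMemory` by name from a modulus + knit at the record»), gen 5,
module 8c″ = the Stage-13 twin (`12 ↦ 13`) of the lineage's module 8c `…N22AtGeneratedHistory12Below.lean` (p489855) at the record OF RECORD (director-ym LINE №125 ∕ №133 ∕ №135;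
route rev 17, K3‴ `SpineGivenEndpointR13` = stmt-QuantumFields-19912; dag-lead WORDS-133 ∕ 134 ∕ 135), with the stub level GENERALISED (like 9″c ∕ 7″) to every Stage-13 reading
carrying the W1 pin `hpin`.  THEOREMS ONLY; imports 8a″ (`…N22EdgeAtW1AdmReadingOfRecord13`, which brings 7″ ∕ 6″ ∕ 9″c ∕ layer B at ₁₃) and module 8c (for its STAGE-FREE §1–§2
`supLetterA_truncRun_toClusterTower_of_holo ∕ _of_schemasBelow` and node00-def-W1's `Node00/HistoryRecursionOfRecord` v1.2 ∕ `RateRecordW1MapsAdm` it brings — reused, not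
re-declared); every proof is ONE application BY NAME; the Stage-13 bundle IS the Stage-12 bundle of the parent tuple (`u3OfRecord₁₃_eq_u3OfRecord₁₂`, `rfl`).  The generator `G`,
tables `sp`, strict class `Pplus`, transport `T₀`, gauge, letters `li` and the residual components `ne2 ∕ ne1` are read PER STAGE-13 TUPLE.  Restate-immune (no Theses import);
COUNT-NEUTRAL; `--supports` K3‴ as a helper.

WHAT IS KERNEL-CHECKED ([folklore]; 0 `def`, 0 `sorry`).
* §1 `n22At_u3OfRecord₁₃_ofRecordAdm_gen_of_n18Below_schemasBelow` (θ-form at one Stage-13 tuple on the generated run towers, sharp package).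
* §2 `s_N22_rRec₁₃Co_w1_gen_of_s_N18_schemasBelow` (ANY `hpin`-reading, canonical home) · `s_N22_rRec₁₃CoOn_w1_gen_of_s_N18_schemasBelow` (regime home) ·
  `s_N22_readingOfRecord₁₃Co_gen_of_s_N18_schemasBelow` · `s_N22_readingOfRecord₁₃CoOn_gen_of_s_N18_schemasBelow` (the reading of record, `hpin := rfl`).
* §3 at W1's GENERATED tables `spGen` (`ReadingData.ofRecordGen`; the transport clause is W1's theorem `hT₀_spGen`): `n22At_u3OfRecord₁₃_ofRecordGen_gen_of_n18Below_schemasBelow` ·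
  `s_N22_readingOfRecord₁₃Co_ofRecordGen_gen_of_s_N18_schemasBelow` · `s_N22_readingOfRecord₁₃CoOn_ofRecordGen_gen_of_s_N18_schemasBelow`.
* §4 IN THE K3‴ SKELETON's CURRENCY: `n22_tupleReadingOfRecordCo_gen_of_n18Below_schemasBelow` (N22's conjunct of `KeyedRates rr` at the level-selected tuple reading of
  record `rr := fun F θ hP g₀ os ↦ rateCarriersOfRecord₁₃Co (readingOfRecord₁₃Co …) F θ hP g₀ os (ksel F θ g₀ os)`, unguarded binder) · `n22_tupleReadingOfRecordCoOn_gen_…` (guarded, any `Rg`).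

HONEST FRAMING.  N22's OWN displayed residual at this reading is ONE inequality schema on the object — the complex sup letter `‖recTerm (G k) (g[i ↦ z]) j X φ‖ ≤
li.A·li.μ^{j−1−i}·e^{−li.κ d_j X}` for `z` in a conj-symmetric open `Dk ⊇` the closed `li.r`-discs ((1.18) at COMPLEX values of one young coupling, NOT PRINTED) — plus W1's two
qualitative per-step schemas and `RecAdmissible` below the run length, `S_N18` at the same reading (dag-n18-d's lane) and numerals; the generator OF RECORD `G` is a PARAMETER
(node00-def-W1 ∕ def-B13 lanes); nothing of Bałaban's is asserted or instantiated — NE5 ∕ NE9 NOT PRINTED for d = 4 and NOT PROVED; no inhabitant of `IsDatumOfRecord₁₃CCo` claimed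
(K0‴ `Record13Inhabited`, stmt-QuantumFields-19909, OPEN); N22 NOT discharged; counts UNMOVED (typed 28∕28 · discharged 5∕27, A 5∕28); one finite four-torus programme at fixed
`ε` — NOT ℝ⁴, NOT infinite volume, NOT OS, NOT a mass gap, NOT Clay.  No decl below carries a cite tag.
-/

noncomputable section

namespace YMDAG.N22

open Set Metric ComplexConjugate
open scoped BigOperators
open Literature.MathematicalPhysics.QuantumFieldTheory.Balaban1983to89
open Literature.MathematicalPhysics.QuantumFieldTheory.Balaban1983to89.T4Continuum
open Literature.MathematicalPhysics.QuantumFieldTheory.Balaban1983to89.T4OutputRate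
open Literature.MathematicalPhysics.QuantumFieldTheory.Balaban1983to89.Node00
  (Stage13Params NE2Objects₁₁ NE3Letters₁₁ MatA ιSU)
open Literature.MathematicalPhysics.QuantumFieldTheory.Balaban1983to89.Node00.Sect2 (domSys CPair ofBackgroundC)
open Literature.MathematicalPhysics.QuantumFieldTheory.Balaban1983to89.Node00.W1
open YMDAG.UVSplit

variable {N : ℕ} [NeZero N]

/-! ## §2 Stub level: any `hpin`-reading, and the Stage-13 reading of record -/

section Stub

variable (G : (F : T4Family) → (θ : Stage13Params F N) → (k : ℕ) → GenTower (F.P k) (MatA N) θ.τ9.M)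
  (sp : (F : T4Family) → (θ : Stage13Params F N) → (k j : ℕ) → (domSys (F.P k) θ.τ9.M j).Dom → Set (CPair (F.P k) (MatA N)))
  (gauge : (F : T4Family) → (θ : Stage13Params F N) → (k : ℕ) → GaugeField (F.P k) 0 (Node00.SU N) → GaugeField (F.P k) 0 (Node00.SU N) → ℝ)
  (hg : ∀ (F : T4Family) (θ : Stage13Params F N) (k : ℕ) (U U' : GaugeField (F.P k) 0 (Node00.SU N)), 0 ≤ gauge F θ k U U')
  (T₀ : (F : T4Family) → (θ : Stage13Params F N) → (k : ℕ) → GaugeField (F.P (k + 1)) 0 (Node00.SU N) → GaugeField (F.P k) 0 (Node00.SU N))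
  (hT₀ : ∀ (F : T4Family) (θ : Stage13Params F N) (k : ℕ) (U : GaugeField (F.P (k + 1)) 0 (Node00.SU N)),
    (∀ (j : ℕ) (Y : (domSys (F.P (k + 1)) θ.τ9.M j).Dom), ofBackgroundC (ιSU N) U ∈ sp F θ (k + 1) j Y) →
    ∀ (j : ℕ) (Y : (domSys (F.P k) θ.τ9.M j).Dom), ofBackgroundC (ιSU N) (T₀ F θ k U) ∈ sp F θ k j Y)
  (li : (F : T4Family) → Stage13Params F N → LetterInputs)
  (ne1 : (F : T4Family) → Stage13Params F N → (ℕ → ℝ) → List (ULoop F) → NE1pCarriers)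

/-- **`S_N22` AT THE CANONICAL STAGE-13 HOME FROM `S_N18` AND THE SHARP SCHEMA PACKAGE**, for ANY Stage-13 reading `𝔯` whose node-U3 objects ARE the admissible W1 reading on
the generated run towers (`hpin`, ONE pointwise equation — `rfl` at the reading of record below): `S_N18 (RRec₁₃Co 𝔯)` + per admissible Stage-13 tuple with provisos and run length
`k` the sharp package (a conj-symmetric open `Dk ⊇` the closed `li.r`-discs about `]0, θ.γ]`, admissible older-term classes, (A-last)ₘ ∕ (A-prop)ₘ for the steps `m < k`, the
complex sup letter for the levels `j ≤ k`) + the eleven numerals ⟹ `S_N22 (RRec₁₃Co 𝔯)` — §1's θ-form at every datum key and run length (9″c's `s_N22_rRec₁₃Co_w1_iff`). [folklore] -/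
theorem s_N22_rRec₁₃Co_w1_gen_of_s_N18_schemasBelow (𝔯 : RateReading₁₃Co N)
    (hpin : ∀ (F : T4Family) (θ : Stage13Params F N) (hP : θ.Provisos₁₃Core F N) (g₀ : ℕ → ℝ) (os : List (ULoop F)), (𝔯.lit F θ hP g₀ os).u3 =
      (ReadingData.ofRecordAdm F θ.τ9.M N (runTowers fun k => toClusterTower (G F θ k)) (sp F θ) (gauge F θ) (hg F θ) (T₀ F θ) (hT₀ F θ) (li F θ)).u3Objects θ.γ)
    (h18 : S_N18 (RRec₁₃Co 𝔯))
    (hsch : ∀ (F : T4Family) (θ : Stage13Params F N), θ.Provisos₁₃Core F N → θ.Admissible F N → ∀ (k : ℕ),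
      ∃ (Dk : Set ℂ) (Adm : (m : ℕ) → Set (OlderTerms (F.P k) (MatA N) θ.τ9.M m)),
        IsOpen Dk ∧ (∀ z ∈ Dk, conj z ∈ Dk) ∧ (∀ t ∈ Ioc (0 : ℝ) θ.γ, closedBall (t : ℂ) (li F θ).r ⊆ Dk) ∧
        (∀ g : ℕ → ℂ, (∀ n, g n ∈ Dk) → ∀ m < k, olderOf (recTerm (G F θ k) g) m ∈ Adm m) ∧
        (∀ m < k, (G F θ k m).AnalyticInLast Dk (Adm m) (sp F θ k (m + 1))) ∧
        (∀ m < k, (G F θ k m).PropagatesAnalyticity Dk (Adm m) (fun j : Fin (m + 1) => sp F θ k j) (sp F θ k (m + 1))) ∧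
        (∀ g ∈ Window θ.γ, ∀ (i j : ℕ), i < j → j ≤ k → ∀ (X : (domSys (F.P k) θ.τ9.M j).Dom), ∀ φ ∈ sp F θ k j X, ∀ z ∈ Dk,
          ‖recTerm (G F θ k) (Function.update (fun n => ((g n : ℝ) : ℂ)) i z) j X φ‖ ≤
            (li F θ).A * (li F θ).μ ^ (j - 1 - i) * Real.exp (-((li F θ).κ * (domSys (F.P k) θ.τ9.M j).dj X))))
    (hnum : ∀ (F : T4Family) (θ : Stage13Params F N), θ.Provisos₁₃Core F N → θ.Admissible F N →
      0 < (li F θ).C₀ ∧ 0 < (li F θ).θ₅ ∧ (li F θ).θ₅ < 1 ∧ 0 ≤ (li F θ).C₅ ∧ 2 * (li F θ).C₅ / (1 - (li F θ).θ₅) ≤ (li F θ).C₀ ∧ 0 < (li F θ).A ∧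
        (li F θ).θ₅ ≤ (li F θ).μ ∧ (li F θ).C₀ ≤ 2 * (li F θ).A ∧ 0 < (li F θ).r ∧ 0 < (li F θ).s ∧ (li F θ).s < 1) :
    S_N22 (RRec₁₃Co 𝔯) := by
  rw [s_N22_rRec₁₃Co_w1_iff 𝔯 (fun F θ => ReadingData.ofRecordAdm F θ.τ9.M N (runTowers fun k => toClusterTower (G F θ k)) (sp F θ) (gauge F θ) (hg F θ) (T₀ F θ) (hT₀ F θ) (li F θ)) hpin]
  rw [s_N18_rRec₁₃Co_iff] at h18
  intro F D h k
  refine n22At_u3OfRecord₁₃_ofRecordAdm_gen_of_n18Below_schemasBelow h.params (G F h.params) (sp F h.params) (gauge F h.params) (hg F h.params)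
    (T₀ F h.params) (hT₀ F h.params) (li F h.params) k (fun k' _ => ?_) (hsch F h.params h.provisos h.admissible k)
    (hnum F h.params h.provisos h.admissible) h.gamma_pos
  have h18' := h18 F D h (fun _ => 0) [] k'
  rw [hpin] at h18'
  exact h18'

/-- **THE SAME AT THE REGIME ∕ TUPLE HOME** `RRec₁₃CoOn 𝔯 Rg` (any `Rg`; `Node00.unityNondeg₁₃ N` is rev 16's binder prefix). [folklore] -/
theorem s_N22_rRec₁₃CoOn_w1_gen_of_s_N18_schemasBelow (𝔯 : RateReading₁₃Co N) (Rg : (F : T4Family) → Stage13Params F N → Prop)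
    (hpin : ∀ (F : T4Family) (θ : Stage13Params F N) (hP : θ.Provisos₁₃Core F N) (g₀ : ℕ → ℝ) (os : List (ULoop F)), (𝔯.lit F θ hP g₀ os).u3 =
      (ReadingData.ofRecordAdm F θ.τ9.M N (runTowers fun k => toClusterTower (G F θ k)) (sp F θ) (gauge F θ) (hg F θ) (T₀ F θ) (hT₀ F θ) (li F θ)).u3Objects θ.γ)
    (h18 : S_N18 (RRec₁₃CoOn 𝔯 Rg))
    (hsch : ∀ (F : T4Family) (θ : Stage13Params F N), θ.Provisos₁₃Core F N → Rg F θ → θ.Admissible F N → ∀ (k : ℕ),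
      ∃ (Dk : Set ℂ) (Adm : (m : ℕ) → Set (OlderTerms (F.P k) (MatA N) θ.τ9.M m)),
        IsOpen Dk ∧ (∀ z ∈ Dk, conj z ∈ Dk) ∧ (∀ t ∈ Ioc (0 : ℝ) θ.γ, closedBall (t : ℂ) (li F θ).r ⊆ Dk) ∧
        (∀ g : ℕ → ℂ, (∀ n, g n ∈ Dk) → ∀ m < k, olderOf (recTerm (G F θ k) g) m ∈ Adm m) ∧
        (∀ m < k, (G F θ k m).AnalyticInLast Dk (Adm m) (sp F θ k (m + 1))) ∧
        (∀ m < k, (G F θ k m).PropagatesAnalyticity Dk (Adm m) (fun j : Fin (m + 1) => sp F θ k j) (sp F θ k (m + 1))) ∧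
        (∀ g ∈ Window θ.γ, ∀ (i j : ℕ), i < j → j ≤ k → ∀ (X : (domSys (F.P k) θ.τ9.M j).Dom), ∀ φ ∈ sp F θ k j X, ∀ z ∈ Dk,
          ‖recTerm (G F θ k) (Function.update (fun n => ((g n : ℝ) : ℂ)) i z) j X φ‖ ≤
            (li F θ).A * (li F θ).μ ^ (j - 1 - i) * Real.exp (-((li F θ).κ * (domSys (F.P k) θ.τ9.M j).dj X))))
    (hnum : ∀ (F : T4Family) (θ : Stage13Params F N), θ.Provisos₁₃Core F N → Rg F θ → θ.Admissible F N →
      0 < (li F θ).C₀ ∧ 0 < (li F θ).θ₅ ∧ (li F θ).θ₅ < 1 ∧ 0 ≤ (li F θ).C₅ ∧ 2 * (li F θ).C₅ / (1 - (li F θ).θ₅) ≤ (li F θ).C₀ ∧ 0 < (li F θ).A ∧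
        (li F θ).θ₅ ≤ (li F θ).μ ∧ (li F θ).C₀ ≤ 2 * (li F θ).A ∧ 0 < (li F θ).r ∧ 0 < (li F θ).s ∧ (li F θ).s < 1) :
    S_N22 (RRec₁₃CoOn 𝔯 Rg) := by
  rw [s_N22_rRec₁₃CoOn_iff]
  rw [s_N18_rRec₁₃CoOn_iff] at h18
  intro F θ hP hRg hθ g₀ os k
  rw [hpin F θ hP g₀ os]
  refine n22At_u3OfRecord₁₃_ofRecordAdm_gen_of_n18Below_schemasBelow θ (G F θ) (sp F θ) (gauge F θ) (hg F θ) (T₀ F θ) (hT₀ F θ) (li F θ) k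
    (fun k' _ => ?_) (hsch F θ hP hRg hθ k) (hnum F θ hP hRg hθ) hθ.toStage9.gamma_pos
  have h18' := h18 F θ hP hRg hθ g₀ os k'
  rw [hpin] at h18'
  exact h18'

variable (ℓ₃ : T4Family → NE3Letters₁₁) (ne2 : (F : T4Family) → Stage13Params F N → (ℕ → ℝ) → List (ULoop F) → ℕ → NE2Objects₁₁)

/-- **THE SAME AT THE STAGE-13 READING OF RECORD, EDITION 1, CANONICAL HOME** (module 6″'s `readingOfRecord₁₃Co` with the admissible W1 component on the generated run towers;
`hpin := rfl`). [folklore] -/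
theorem s_N22_readingOfRecord₁₃Co_gen_of_s_N18_schemasBelow
    (h18 : S_N18 (RRec₁₃Co (readingOfRecord₁₃Co (fun F θ => ReadingData.ofRecordAdm F θ.τ9.M N (runTowers fun k => toClusterTower (G F θ k)) (sp F θ) (gauge F θ) (hg F θ) (T₀ F θ) (hT₀ F θ) (li F θ)) ℓ₃ ne2 ne1)))
    (hsch : ∀ (F : T4Family) (θ : Stage13Params F N), θ.Provisos₁₃Core F N → θ.Admissible F N → ∀ (k : ℕ),
      ∃ (Dk : Set ℂ) (Adm : (m : ℕ) → Set (OlderTerms (F.P k) (MatA N) θ.τ9.M m)),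
        IsOpen Dk ∧ (∀ z ∈ Dk, conj z ∈ Dk) ∧ (∀ t ∈ Ioc (0 : ℝ) θ.γ, closedBall (t : ℂ) (li F θ).r ⊆ Dk) ∧
        (∀ g : ℕ → ℂ, (∀ n, g n ∈ Dk) → ∀ m < k, olderOf (recTerm (G F θ k) g) m ∈ Adm m) ∧
        (∀ m < k, (G F θ k m).AnalyticInLast Dk (Adm m) (sp F θ k (m + 1))) ∧
        (∀ m < k, (G F θ k m).PropagatesAnalyticity Dk (Adm m) (fun j : Fin (m + 1) => sp F θ k j) (sp F θ k (m + 1))) ∧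
        (∀ g ∈ Window θ.γ, ∀ (i j : ℕ), i < j → j ≤ k → ∀ (X : (domSys (F.P k) θ.τ9.M j).Dom), ∀ φ ∈ sp F θ k j X, ∀ z ∈ Dk,
          ‖recTerm (G F θ k) (Function.update (fun n => ((g n : ℝ) : ℂ)) i z) j X φ‖ ≤
            (li F θ).A * (li F θ).μ ^ (j - 1 - i) * Real.exp (-((li F θ).κ * (domSys (F.P k) θ.τ9.M j).dj X))))
    (hnum : ∀ (F : T4Family) (θ : Stage13Params F N), θ.Provisos₁₃Core F N → θ.Admissible F N →
      0 < (li F θ).C₀ ∧ 0 < (li F θ).θ₅ ∧ (li F θ).θ₅ < 1 ∧ 0 ≤ (li F θ).C₅ ∧ 2 * (li F θ).C₅ / (1 - (li F θ).θ₅) ≤ (li F θ).C₀ ∧ 0 < (li F θ).A ∧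
        (li F θ).θ₅ ≤ (li F θ).μ ∧ (li F θ).C₀ ≤ 2 * (li F θ).A ∧ 0 < (li F θ).r ∧ 0 < (li F θ).s ∧ (li F θ).s < 1) :
    S_N22 (RRec₁₃Co (readingOfRecord₁₃Co (fun F θ => ReadingData.ofRecordAdm F θ.τ9.M N (runTowers fun k => toClusterTower (G F θ k)) (sp F θ) (gauge F θ) (hg F θ) (T₀ F θ) (hT₀ F θ) (li F θ)) ℓ₃ ne2 ne1)) :=
  s_N22_rRec₁₃Co_w1_gen_of_s_N18_schemasBelow G sp gauge hg T₀ hT₀ li _ (fun _ _ _ _ _ => rfl) h18 hsch hnum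

/-- **THE SAME AT THE STAGE-13 READING OF RECORD, EDITION 1, REGIME ∕ TUPLE HOME** (any `Rg`; `hpin := rfl`). [folklore] -/
theorem s_N22_readingOfRecord₁₃CoOn_gen_of_s_N18_schemasBelow (Rg : (F : T4Family) → Stage13Params F N → Prop)
    (h18 : S_N18 (RRec₁₃CoOn (readingOfRecord₁₃Co (fun F θ => ReadingData.ofRecordAdm F θ.τ9.M N (runTowers fun k => toClusterTower (G F θ k)) (sp F θ) (gauge F θ) (hg F θ) (T₀ F θ) (hT₀ F θ) (li F θ)) ℓ₃ ne2 ne1) Rg))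
    (hsch : ∀ (F : T4Family) (θ : Stage13Params F N), θ.Provisos₁₃Core F N → Rg F θ → θ.Admissible F N → ∀ (k : ℕ),
      ∃ (Dk : Set ℂ) (Adm : (m : ℕ) → Set (OlderTerms (F.P k) (MatA N) θ.τ9.M m)),
        IsOpen Dk ∧ (∀ z ∈ Dk, conj z ∈ Dk) ∧ (∀ t ∈ Ioc (0 : ℝ) θ.γ, closedBall (t : ℂ) (li F θ).r ⊆ Dk) ∧
        (∀ g : ℕ → ℂ, (∀ n, g n ∈ Dk) → ∀ m < k, olderOf (recTerm (G F θ k) g) m ∈ Adm m) ∧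
        (∀ m < k, (G F θ k m).AnalyticInLast Dk (Adm m) (sp F θ k (m + 1))) ∧
        (∀ m < k, (G F θ k m).PropagatesAnalyticity Dk (Adm m) (fun j : Fin (m + 1) => sp F θ k j) (sp F θ k (m + 1))) ∧
        (∀ g ∈ Window θ.γ, ∀ (i j : ℕ), i < j → j ≤ k → ∀ (X : (domSys (F.P k) θ.τ9.M j).Dom), ∀ φ ∈ sp F θ k j X, ∀ z ∈ Dk,
          ‖recTerm (G F θ k) (Function.update (fun n => ((g n : ℝ) : ℂ)) i z) j X φ‖ ≤
            (li F θ).A * (li F θ).μ ^ (j - 1 - i) * Real.exp (-((li F θ).κ * (domSys (F.P k) θ.τ9.M j).dj X))))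
    (hnum : ∀ (F : T4Family) (θ : Stage13Params F N), θ.Provisos₁₃Core F N → Rg F θ → θ.Admissible F N →
      0 < (li F θ).C₀ ∧ 0 < (li F θ).θ₅ ∧ (li F θ).θ₅ < 1 ∧ 0 ≤ (li F θ).C₅ ∧ 2 * (li F θ).C₅ / (1 - (li F θ).θ₅) ≤ (li F θ).C₀ ∧ 0 < (li F θ).A ∧
        (li F θ).θ₅ ≤ (li F θ).μ ∧ (li F θ).C₀ ≤ 2 * (li F θ).A ∧ 0 < (li F θ).r ∧ 0 < (li F θ).s ∧ (li F θ).s < 1) :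
    S_N22 (RRec₁₃CoOn (readingOfRecord₁₃Co (fun F θ => ReadingData.ofRecordAdm F θ.τ9.M N (runTowers fun k => toClusterTower (G F θ k)) (sp F θ) (gauge F θ) (hg F θ) (T₀ F θ) (hT₀ F θ) (li F θ)) ℓ₃ ne2 ne1) Rg) :=
  s_N22_rRec₁₃CoOn_w1_gen_of_s_N18_schemasBelow G sp gauge hg T₀ hT₀ li _ Rg (fun _ _ _ _ _ => rfl) h18 hsch hnum

end Stub

section GenStub

variable (G : (F : T4Family) → (θ : Stage13Params F N) → (k : ℕ) → GenTower (F.P k) (MatA N) θ.τ9.M)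
  (Pplus : (F : T4Family) → (θ : Stage13Params F N) → (k : ℕ) → GaugeField (F.P k) 0 (Node00.SU N) → Prop)
  (T₀ : (F : T4Family) → (θ : Stage13Params F N) → (k : ℕ) → GaugeField (F.P (k + 1)) 0 (Node00.SU N) → GaugeField (F.P k) 0 (Node00.SU N))
  (gauge : (F : T4Family) → (θ : Stage13Params F N) → (k : ℕ) → GaugeField (F.P k) 0 (Node00.SU N) → GaugeField (F.P k) 0 (Node00.SU N) → ℝ)
  (hg : ∀ (F : T4Family) (θ : Stage13Params F N) (k : ℕ) (U U' : GaugeField (F.P k) 0 (Node00.SU N)), 0 ≤ gauge F θ k U U')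
  (li : (F : T4Family) → Stage13Params F N → LetterInputs) (ℓ₃ : T4Family → NE3Letters₁₁)
  (ne2 : (F : T4Family) → Stage13Params F N → (ℕ → ℝ) → List (ULoop F) → ℕ → NE2Objects₁₁)
  (ne1 : (F : T4Family) → Stage13Params F N → (ℕ → ℝ) → List (ULoop F) → NE1pCarriers)

/-- **`S_N22` AT THE STAGE-13 READING OF RECORD WHOSE W1 COMPONENT IS `ReadingData.ofRecordGen` ON THE GENERATED RUN TOWERS** (canonical home): `S_N18` at the same reading +
the sharp schema package at the generated tables per admissible Stage-13 tuple with provisos and run length + numerals ⟹ `S_N22` — the `ofRecordAdm` face at `spGen` ∕ `hT₀_spGen`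
(`ofRecordGen` IS `ofRecordAdm` there, `rfl`).  NO transport clause, NO coherence, NO (J), NO readings clause. [folklore] -/
theorem s_N22_readingOfRecord₁₃Co_ofRecordGen_gen_of_s_N18_schemasBelow
    (h18 : S_N18 (RRec₁₃Co (readingOfRecord₁₃Co (fun F θ => ReadingData.ofRecordGen F θ.τ9.M N (Pplus F θ) (T₀ F θ) (runTowers fun k => toClusterTower (G F θ k)) (gauge F θ) (hg F θ) (li F θ)) ℓ₃ ne2 ne1)))
    (hsch : ∀ (F : T4Family) (θ : Stage13Params F N), θ.Provisos₁₃Core F N → θ.Admissible F N → ∀ (k : ℕ),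
      ∃ (Dk : Set ℂ) (Adm : (m : ℕ) → Set (OlderTerms (F.P k) (MatA N) θ.τ9.M m)),
        IsOpen Dk ∧ (∀ z ∈ Dk, conj z ∈ Dk) ∧ (∀ t ∈ Ioc (0 : ℝ) θ.γ, closedBall (t : ℂ) (li F θ).r ⊆ Dk) ∧
        (∀ g : ℕ → ℂ, (∀ n, g n ∈ Dk) → ∀ m < k, olderOf (recTerm (G F θ k) g) m ∈ Adm m) ∧
        (∀ m < k, (G F θ k m).AnalyticInLast Dk (Adm m) (spGen F θ.τ9.M N (Pplus F θ) (T₀ F θ) k (m + 1))) ∧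
        (∀ m < k, (G F θ k m).PropagatesAnalyticity Dk (Adm m) (fun j : Fin (m + 1) => spGen F θ.τ9.M N (Pplus F θ) (T₀ F θ) k j) (spGen F θ.τ9.M N (Pplus F θ) (T₀ F θ) k (m + 1))) ∧
        (∀ g ∈ Window θ.γ, ∀ (i j : ℕ), i < j → j ≤ k → ∀ (X : (domSys (F.P k) θ.τ9.M j).Dom), ∀ φ ∈ spGen F θ.τ9.M N (Pplus F θ) (T₀ F θ) k j X, ∀ z ∈ Dk,
          ‖recTerm (G F θ k) (Function.update (fun n => ((g n : ℝ) : ℂ)) i z) j X φ‖ ≤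
            (li F θ).A * (li F θ).μ ^ (j - 1 - i) * Real.exp (-((li F θ).κ * (domSys (F.P k) θ.τ9.M j).dj X))))
    (hnum : ∀ (F : T4Family) (θ : Stage13Params F N), θ.Provisos₁₃Core F N → θ.Admissible F N →
      0 < (li F θ).C₀ ∧ 0 < (li F θ).θ₅ ∧ (li F θ).θ₅ < 1 ∧ 0 ≤ (li F θ).C₅ ∧ 2 * (li F θ).C₅ / (1 - (li F θ).θ₅) ≤ (li F θ).C₀ ∧ 0 < (li F θ).A ∧
        (li F θ).θ₅ ≤ (li F θ).μ ∧ (li F θ).C₀ ≤ 2 * (li F θ).A ∧ 0 < (li F θ).r ∧ 0 < (li F θ).s ∧ (li F θ).s < 1) :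
    S_N22 (RRec₁₃Co (readingOfRecord₁₃Co (fun F θ => ReadingData.ofRecordGen F θ.τ9.M N (Pplus F θ) (T₀ F θ) (runTowers fun k => toClusterTower (G F θ k)) (gauge F θ) (hg F θ) (li F θ)) ℓ₃ ne2 ne1)) :=
  s_N22_rRec₁₃Co_w1_gen_of_s_N18_schemasBelow G (fun F θ => spGen F θ.τ9.M N (Pplus F θ) (T₀ F θ)) gauge hg T₀
    (fun F θ => hT₀_spGen F θ.τ9.M N (Pplus F θ) (T₀ F θ)) li _ (fun _ _ _ _ _ => rfl) h18 hsch hnum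

/-- **THE SAME AT THE REGIME ∕ TUPLE HOME** (any `Rg`; at `Rg := Node00.unityNondeg₁₃ N` this is rev 16's binder prefix «`(θ.ZtUnity F N ∧ θ.SlotsNondegenerate₁₃ F N) →
θ.Admissible F N → …`» read at the reading of record on the generated towers). [folklore] -/
theorem s_N22_readingOfRecord₁₃CoOn_ofRecordGen_gen_of_s_N18_schemasBelow (Rg : (F : T4Family) → Stage13Params F N → Prop)
    (h18 : S_N18 (RRec₁₃CoOn (readingOfRecord₁₃Co (fun F θ => ReadingData.ofRecordGen F θ.τ9.M N (Pplus F θ) (T₀ F θ) (runTowers fun k => toClusterTower (G F θ k)) (gauge F θ) (hg F θ) (li F θ)) ℓ₃ ne2 ne1) Rg))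
    (hsch : ∀ (F : T4Family) (θ : Stage13Params F N), θ.Provisos₁₃Core F N → Rg F θ → θ.Admissible F N → ∀ (k : ℕ),
      ∃ (Dk : Set ℂ) (Adm : (m : ℕ) → Set (OlderTerms (F.P k) (MatA N) θ.τ9.M m)),
        IsOpen Dk ∧ (∀ z ∈ Dk, conj z ∈ Dk) ∧ (∀ t ∈ Ioc (0 : ℝ) θ.γ, closedBall (t : ℂ) (li F θ).r ⊆ Dk) ∧
        (∀ g : ℕ → ℂ, (∀ n, g n ∈ Dk) → ∀ m < k, olderOf (recTerm (G F θ k) g) m ∈ Adm m) ∧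
        (∀ m < k, (G F θ k m).AnalyticInLast Dk (Adm m) (spGen F θ.τ9.M N (Pplus F θ) (T₀ F θ) k (m + 1))) ∧
        (∀ m < k, (G F θ k m).PropagatesAnalyticity Dk (Adm m) (fun j : Fin (m + 1) => spGen F θ.τ9.M N (Pplus F θ) (T₀ F θ) k j) (spGen F θ.τ9.M N (Pplus F θ) (T₀ F θ) k (m + 1))) ∧
        (∀ g ∈ Window θ.γ, ∀ (i j : ℕ), i < j → j ≤ k → ∀ (X : (domSys (F.P k) θ.τ9.M j).Dom), ∀ φ ∈ spGen F θ.τ9.M N (Pplus F θ) (T₀ F θ) k j X, ∀ z ∈ Dk,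
          ‖recTerm (G F θ k) (Function.update (fun n => ((g n : ℝ) : ℂ)) i z) j X φ‖ ≤
            (li F θ).A * (li F θ).μ ^ (j - 1 - i) * Real.exp (-((li F θ).κ * (domSys (F.P k) θ.τ9.M j).dj X))))
    (hnum : ∀ (F : T4Family) (θ : Stage13Params F N), θ.Provisos₁₃Core F N → Rg F θ → θ.Admissible F N →
      0 < (li F θ).C₀ ∧ 0 < (li F θ).θ₅ ∧ (li F θ).θ₅ < 1 ∧ 0 ≤ (li F θ).C₅ ∧ 2 * (li F θ).C₅ / (1 - (li F θ).θ₅) ≤ (li F θ).C₀ ∧ 0 < (li F θ).A ∧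
        (li F θ).θ₅ ≤ (li F θ).μ ∧ (li F θ).C₀ ≤ 2 * (li F θ).A ∧ 0 < (li F θ).r ∧ 0 < (li F θ).s ∧ (li F θ).s < 1) :
    S_N22 (RRec₁₃CoOn (readingOfRecord₁₃Co (fun F θ => ReadingData.ofRecordGen F θ.τ9.M N (Pplus F θ) (T₀ F θ) (runTowers fun k => toClusterTower (G F θ k)) (gauge F θ) (hg F θ) (li F θ)) ℓ₃ ne2 ne1) Rg) :=
  s_N22_rRec₁₃CoOn_w1_gen_of_s_N18_schemasBelow G (fun F θ => spGen F θ.τ9.M N (Pplus F θ) (T₀ F θ)) gauge hg T₀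
    (fun F θ => hT₀_spGen F θ.τ9.M N (Pplus F θ) (T₀ F θ)) li _ Rg (fun _ _ _ _ _ => rfl) h18 hsch hnum

end GenStub

/-! ## §4 IN THE K3‴ SKELETON'S OWN CURRENCY: N22's conjunct of `KeyedRates rr` at the LEVEL-SELECTED tuple reading of record (plan g66 `D66-REV16/K3Skeleton13.lean`:
`rr : RateReading 2`, `KeyedRates rr := ∀ F θ hP, θ.Admissible F N → ∀ g₀ os, RatesAt (datumOfRecord₁₃Co F N θ hP) (rr F θ hP g₀ os)`, N22's conjunct = `N22At (rr …).u3`;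
the home's witness `rr F θ hP g₀ os := rateCarriersOfRecord₁₃Co (readingOfRecord₁₃Co …) F θ hP g₀ os (ksel F θ g₀ os)` of 5″ §5) -/

section TupleReading

variable (G : (F : T4Family) → (θ : Stage13Params F N) → (k : ℕ) → GenTower (F.P k) (MatA N) θ.τ9.M)
  (sp : (F : T4Family) → (θ : Stage13Params F N) → (k j : ℕ) → (domSys (F.P k) θ.τ9.M j).Dom → Set (CPair (F.P k) (MatA N)))
  (gauge : (F : T4Family) → (θ : Stage13Params F N) → (k : ℕ) → GaugeField (F.P k) 0 (Node00.SU N) → GaugeField (F.P k) 0 (Node00.SU N) → ℝ)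
  (hg : ∀ (F : T4Family) (θ : Stage13Params F N) (k : ℕ) (U U' : GaugeField (F.P k) 0 (Node00.SU N)), 0 ≤ gauge F θ k U U')
  (T₀ : (F : T4Family) → (θ : Stage13Params F N) → (k : ℕ) → GaugeField (F.P (k + 1)) 0 (Node00.SU N) → GaugeField (F.P k) 0 (Node00.SU N))
  (hT₀ : ∀ (F : T4Family) (θ : Stage13Params F N) (k : ℕ) (U : GaugeField (F.P (k + 1)) 0 (Node00.SU N)),
    (∀ (j : ℕ) (Y : (domSys (F.P (k + 1)) θ.τ9.M j).Dom), ofBackgroundC (ιSU N) U ∈ sp F θ (k + 1) j Y) →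
    ∀ (j : ℕ) (Y : (domSys (F.P k) θ.τ9.M j).Dom), ofBackgroundC (ιSU N) (T₀ F θ k U) ∈ sp F θ k j Y)
  (li : (F : T4Family) → Stage13Params F N → LetterInputs) (ℓ₃ : T4Family → NE3Letters₁₁)
  (ne2 : (F : T4Family) → Stage13Params F N → (ℕ → ℝ) → List (ULoop F) → ℕ → NE2Objects₁₁)
  (ne1 : (F : T4Family) → Stage13Params F N → (ℕ → ℝ) → List (ULoop F) → NE1pCarriers)
  (ksel : (F : T4Family) → Stage13Params F N → (ℕ → ℝ) → List (ULoop F) → ℕ)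

/-- **N22's CONJUNCT OF `KeyedRates rr` AT THE LEVEL-SELECTED TUPLE READING OF RECORD ON THE GENERATED ADMISSIBLE TOWERS** (the skeleton's unguarded binder
«`∀ F θ hP, θ.Admissible F N → ∀ g₀ os, N22At (rr F θ hP g₀ os).u3`» for `rr F θ hP g₀ os := rateCarriersOfRecord₁₃Co (readingOfRecord₁₃Co …) F θ hP g₀ os (ksel F θ g₀ os)`): node N18
at the run lengths BELOW the selected one at the same reading + the sharp schema package at the selected run length + numerals ⟹ the conjunct — §1's θ-form once per admissible
tuple (`readingOfRecord₁₃Co_bundle_u3`, `rfl`).  The K3‴ composer conjoins this with the other five nodes' conjuncts at the same `rr`. [folklore] -/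
theorem n22_tupleReadingOfRecordCo_gen_of_n18Below_schemasBelow
    (h18 : ∀ (F : T4Family) (θ : Stage13Params F N) (hP : θ.Provisos₁₃Core F N), θ.Admissible F N → ∀ (g₀ : ℕ → ℝ) (os : List (ULoop F)),
      ∀ k' : ℕ, k' < ksel F θ g₀ os → N18At (u3OfRecord₁₃ θ ((ReadingData.ofRecordAdm F θ.τ9.M N (runTowers fun k => toClusterTower (G F θ k)) (sp F θ) (gauge F θ) (hg F θ) (T₀ F θ) (hT₀ F θ) (li F θ)).u3Objects θ.γ) k'))
    (hsch : ∀ (F : T4Family) (θ : Stage13Params F N), θ.Provisos₁₃Core F N → θ.Admissible F N → ∀ (g₀ : ℕ → ℝ) (os : List (ULoop F)),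
      ∃ (Dk : Set ℂ) (Adm : (m : ℕ) → Set (OlderTerms (F.P (ksel F θ g₀ os)) (MatA N) θ.τ9.M m)),
        IsOpen Dk ∧ (∀ z ∈ Dk, conj z ∈ Dk) ∧ (∀ t ∈ Ioc (0 : ℝ) θ.γ, closedBall (t : ℂ) (li F θ).r ⊆ Dk) ∧
        (∀ g : ℕ → ℂ, (∀ n, g n ∈ Dk) → ∀ m < ksel F θ g₀ os, olderOf (recTerm (G F θ (ksel F θ g₀ os)) g) m ∈ Adm m) ∧
        (∀ m < ksel F θ g₀ os, (G F θ (ksel F θ g₀ os) m).AnalyticInLast Dk (Adm m) (sp F θ (ksel F θ g₀ os) (m + 1))) ∧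
        (∀ m < ksel F θ g₀ os, (G F θ (ksel F θ g₀ os) m).PropagatesAnalyticity Dk (Adm m) (fun j : Fin (m + 1) => sp F θ (ksel F θ g₀ os) j)
          (sp F θ (ksel F θ g₀ os) (m + 1))) ∧
        (∀ g ∈ Window θ.γ, ∀ (i j : ℕ), i < j → j ≤ ksel F θ g₀ os → ∀ (X : (domSys (F.P (ksel F θ g₀ os)) θ.τ9.M j).Dom),
          ∀ φ ∈ sp F θ (ksel F θ g₀ os) j X, ∀ z ∈ Dk,
            ‖recTerm (G F θ (ksel F θ g₀ os)) (Function.update (fun n => ((g n : ℝ) : ℂ)) i z) j X φ‖ ≤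
              (li F θ).A * (li F θ).μ ^ (j - 1 - i) * Real.exp (-((li F θ).κ * (domSys (F.P (ksel F θ g₀ os)) θ.τ9.M j).dj X))))
    (hnum : ∀ (F : T4Family) (θ : Stage13Params F N), θ.Provisos₁₃Core F N → θ.Admissible F N →
      0 < (li F θ).C₀ ∧ 0 < (li F θ).θ₅ ∧ (li F θ).θ₅ < 1 ∧ 0 ≤ (li F θ).C₅ ∧ 2 * (li F θ).C₅ / (1 - (li F θ).θ₅) ≤ (li F θ).C₀ ∧ 0 < (li F θ).A ∧
        (li F θ).θ₅ ≤ (li F θ).μ ∧ (li F θ).C₀ ≤ 2 * (li F θ).A ∧ 0 < (li F θ).r ∧ 0 < (li F θ).s ∧ (li F θ).s < 1) :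
    ∀ (F : T4Family) (θ : Stage13Params F N) (hP : θ.Provisos₁₃Core F N), θ.Admissible F N → ∀ (g₀ : ℕ → ℝ) (os : List (ULoop F)),
      N22At (rateCarriersOfRecord₁₃Co (readingOfRecord₁₃Co (fun F θ => ReadingData.ofRecordAdm F θ.τ9.M N (runTowers fun k => toClusterTower (G F θ k)) (sp F θ) (gauge F θ) (hg F θ) (T₀ F θ) (hT₀ F θ) (li F θ)) ℓ₃ ne2 ne1) F θ hP g₀ os (ksel F θ g₀ os)).u3 :=
  fun F θ hP hθ g₀ os =>
    n22At_u3OfRecord₁₃_ofRecordAdm_gen_of_n18Below_schemasBelow θ (G F θ) (sp F θ) (gauge F θ) (hg F θ) (T₀ F θ) (hT₀ F θ) (li F θ) (ksel F θ g₀ os)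
      (h18 F θ hP hθ g₀ os) (hsch F θ hP hθ g₀ os) (hnum F θ hP hθ) hθ.toStage9.gamma_pos

/-- **… AND GUARDED** (rev 16's binder prefix: the conjunct is asked only of the tuples with `(θ.ZtUnity F N ∧ θ.SlotsNondegenerate₁₃ F N)`, i.e. in RR-2's guard of record
`Node00.unityNondeg₁₃ N`, or any regime `Rg`; every hypothesis asked only there). [folklore] -/
theorem n22_tupleReadingOfRecordCoOn_gen_of_n18Below_schemasBelow (Rg : (F : T4Family) → Stage13Params F N → Prop)
    (h18 : ∀ (F : T4Family) (θ : Stage13Params F N) (hP : θ.Provisos₁₃Core F N), Rg F θ → θ.Admissible F N → ∀ (g₀ : ℕ → ℝ) (os : List (ULoop F)),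
      ∀ k' : ℕ, k' < ksel F θ g₀ os → N18At (u3OfRecord₁₃ θ ((ReadingData.ofRecordAdm F θ.τ9.M N (runTowers fun k => toClusterTower (G F θ k)) (sp F θ) (gauge F θ) (hg F θ) (T₀ F θ) (hT₀ F θ) (li F θ)).u3Objects θ.γ) k'))
    (hsch : ∀ (F : T4Family) (θ : Stage13Params F N), θ.Provisos₁₃Core F N → Rg F θ → θ.Admissible F N → ∀ (g₀ : ℕ → ℝ) (os : List (ULoop F)),
      ∃ (Dk : Set ℂ) (Adm : (m : ℕ) → Set (OlderTerms (F.P (ksel F θ g₀ os)) (MatA N) θ.τ9.M m)),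
        IsOpen Dk ∧ (∀ z ∈ Dk, conj z ∈ Dk) ∧ (∀ t ∈ Ioc (0 : ℝ) θ.γ, closedBall (t : ℂ) (li F θ).r ⊆ Dk) ∧
        (∀ g : ℕ → ℂ, (∀ n, g n ∈ Dk) → ∀ m < ksel F θ g₀ os, olderOf (recTerm (G F θ (ksel F θ g₀ os)) g) m ∈ Adm m) ∧
        (∀ m < ksel F θ g₀ os, (G F θ (ksel F θ g₀ os) m).AnalyticInLast Dk (Adm m) (sp F θ (ksel F θ g₀ os) (m + 1))) ∧
        (∀ m < ksel F θ g₀ os, (G F θ (ksel F θ g₀ os) m).PropagatesAnalyticity Dk (Adm m) (fun j : Fin (m + 1) => sp F θ (ksel F θ g₀ os) j)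
          (sp F θ (ksel F θ g₀ os) (m + 1))) ∧
        (∀ g ∈ Window θ.γ, ∀ (i j : ℕ), i < j → j ≤ ksel F θ g₀ os → ∀ (X : (domSys (F.P (ksel F θ g₀ os)) θ.τ9.M j).Dom),
          ∀ φ ∈ sp F θ (ksel F θ g₀ os) j X, ∀ z ∈ Dk,
            ‖recTerm (G F θ (ksel F θ g₀ os)) (Function.update (fun n => ((g n : ℝ) : ℂ)) i z) j X φ‖ ≤
              (li F θ).A * (li F θ).μ ^ (j - 1 - i) * Real.exp (-((li F θ).κ * (domSys (F.P (ksel F θ g₀ os)) θ.τ9.M j).dj X))))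
    (hnum : ∀ (F : T4Family) (θ : Stage13Params F N), θ.Provisos₁₃Core F N → Rg F θ → θ.Admissible F N →
      0 < (li F θ).C₀ ∧ 0 < (li F θ).θ₅ ∧ (li F θ).θ₅ < 1 ∧ 0 ≤ (li F θ).C₅ ∧ 2 * (li F θ).C₅ / (1 - (li F θ).θ₅) ≤ (li F θ).C₀ ∧ 0 < (li F θ).A ∧
        (li F θ).θ₅ ≤ (li F θ).μ ∧ (li F θ).C₀ ≤ 2 * (li F θ).A ∧ 0 < (li F θ).r ∧ 0 < (li F θ).s ∧ (li F θ).s < 1) :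
    ∀ (F : T4Family) (θ : Stage13Params F N) (hP : θ.Provisos₁₃Core F N), Rg F θ → θ.Admissible F N → ∀ (g₀ : ℕ → ℝ) (os : List (ULoop F)),
      N22At (rateCarriersOfRecord₁₃Co (readingOfRecord₁₃Co (fun F θ => ReadingData.ofRecordAdm F θ.τ9.M N (runTowers fun k => toClusterTower (G F θ k)) (sp F θ) (gauge F θ) (hg F θ) (T₀ F θ) (hT₀ F θ) (li F θ)) ℓ₃ ne2 ne1) F θ hP g₀ os (ksel F θ g₀ os)).u3 :=
  fun F θ hP hRg hθ g₀ os =>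
    n22At_u3OfRecord₁₃_ofRecordAdm_gen_of_n18Below_schemasBelow θ (G F θ) (sp F θ) (gauge F θ) (hg F θ) (T₀ F θ) (hT₀ F θ) (li F θ) (ksel F θ g₀ os)
      (h18 F θ hP hRg hθ g₀ os) (hsch F θ hP hRg hθ g₀ os) (hnum F θ hP hRg hθ) hθ.toStage9.gamma_pos

end TupleReading

end YMDAG.N22

end
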